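import Literature.NumberTheory.GaloisCohomology.KolyvaginSystems
import HarnessLib

/-!
# Kolyvagin LEDGER ALGEBRA: the finite-group bookkeeping of the (a′) lower bound at `p = 3`
# (team n1011, ROUTE-1 §20.4 (C20), sub-target R1-23, skeleton `cells/n1011/skel/T-R1-23.md`; p18)

HONEST FRAMING (cell `b2b-bsdres`, run/shared/lean/b2b/bsd-rank1-residual/, verbatim in every
file): the goal of the cell is to DELETE the COMBINATION-SHAPED residual classes of the
Birch–Swinnerton-Dyer formula for ALL analytic-rank `≤ 1` elliptic curves over `ℚ` — "full BSD
formula for every rank `≤ 1` curve in class `C`" assembled STRICTLY from published theorems — so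
that the rank-`≤ 1` remainder becomes exactly the CONSTRUCTION-SHAPED classes, which are TYPED
(missing-input `Prop`s), NOT attempted. This is not "finishing BSD". Team n1011 (N10/N11, the
additive block `X4 ∧ p = 3`): research route; TOOL theorems of elementary algebra (finite abelian
groups, `ℤ/p^K`), no Galois object, no class theorem, nothing booked, no mark changed, no fact.

## What and why

The (a′) assembly (R1-23: a non-zero Kurihara number `δ̃_n ≢ 0 (mod 3^j)` at a Kolyvagin product
of level `j + t` gives `ord₃(L(E,1)/Ω) ≤ ord₃ #Ш[3^∞] + (j − 1)`) is, after the Galois cohomology is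
supplied by the typed inputs (Sakamoto 2024 Thm. 4.4 (1)/(2), the Kato–Kurihara dictionary, the
finite Poitou–Tate count), a chain of statements about a finite abelian group `G` killed by `p^K`,
an additive map `Λ : G → ℤ/p^K`, a cyclic group of Kolyvagin systems `KS ≃ ℤ/p^K` and its
generator `g`.  This file proves exactly those statements, once, generically:

* §1 generators: from `KS ≃+ ℤ/N` (the tree's `KolyvaginSystem.IsFreeRankOneZMod`) an element `g`
  of additive order `N` with every element a natural multiple of `g`
  (`exists_generator_of_isFreeRankOneZMod`); a family `g : ι → A` of additive order `p^K`, `K ≥ 1`,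
  has a COORDINATE of additive order `p^K` (`exists_addOrderOf_apply_eq_pow`) — the existence of a
  CORE VERTEX from Thm. 4.4 (1)+(2) (skeleton step S2);
* §2 the unitriangular bridge ([MR04] App. A (33)): if `κ′_d − κ_d` lies in the subgroup generated
  by the `κ_c`, `c ⊊ d`, and a functional `L` sends every such `κ_c` into an ideal `J`, then
  `L κ′_d ≡ L κ_d (mod J)` (`apply_sub_apply_mem_of_sub_mem_closure`); and the certificate step: if
  `κ′_d = a • g_d` and `L κ′_d ∉ J` then `(a : R) ∉ J` (`natCast_not_mem_of_apply_nsmul_not_mem`)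
  (step S1);
* §3 scalar transport between two levels through one core vertex (step S3): orders of `p`-power
  multiples, "onto at a core vertex forces a unit" (`not_dvd_of_addOrderOf_nsmul_eq`,
  `not_dvd_of_comp_eq_pow_nsmul`), and `(a′ w) • y = a • y`, `p ∤ w` ⟹ `p^s ∣ a ↔ p^s ∣ a′` for
  `s ≤` the exponent of `y` (`pow_dvd_iff_of_mul_nsmul_eq_nsmul`);
* §4 the deep-ledger lemma (step S5): if `ker Λ` is killed by `p^X`, `Λ x = p^c`, `p^K x = 0`,
  `Λ g = p^β u` and `X + β ≤ K + c`, then `p^{K+c−β} g = 0` (`pow_nsmul_eq_zero_of_ledger`); with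
  the ORDER form of Thm. 4.4 (2), `addOrderOf g · N_∅ = p^K`, this gives `p^{β−c} ∣ N_∅`
  (`pow_dvd_of_addOrderOf_mul_eq`);
* §5 the valuation dictionary in `ℤ/p^K` ("`ord_p x ≥ s`" as divisibility by `p^s`; visibility
  of the `L`-value at a deep level: `exists_eq_pow_mul_unit_of_natCast_mul_eq`, step S4).

References: Mazur–Rubin, Mem. AMS 799 (2004), App. A (33), Thm. 4.4.1 [MazurRubin2004]; Sakamoto,
JTNB 36 (2024) Thm. 4.4 [Sakamoto2024]; C.-H. Kim, AJM 148 (2026) §1.4.3, Thm. 3.13 [Kim2022StructureSelmer].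
-/

namespace Summit.BirchSwinnertonDyer.Rank1Residual.GaloisImage.Ledger

open Literature.NumberTheory.GaloisCohomology

/-! ## §0 Additive orders that are prime powers -/
section Orders
variable {A : Type*} [AddCommGroup A] {p : ℕ} [hp : Fact p.Prime]

/-- An element killed by `p^K` but not by `p^(K-1)` (`K ≥ 1`) has additive order exactly `p^K`.
[folklore] -/
theorem addOrderOf_eq_pow_of_nsmul (x : A) {K : ℕ} (hK : 0 < K) (h0 : p ^ K • x = 0)
    (h1 : p ^ (K - 1) • x ≠ 0) : addOrderOf x = p ^ K := by
  obtain ⟨m, hmK, hm⟩ := (Nat.dvd_prime_pow hp.out).1 (addOrderOf_dvd_of_nsmul_eq_zero h0)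
  rw [hm]
  rcases Nat.lt_or_ge m K with hlt | hge
  · exfalso
    apply h1
    have hdvd : addOrderOf x ∣ p ^ (K - 1) := by
      rw [hm]
      exact Nat.pow_dvd_pow p (by omega)
    exact addOrderOf_dvd_iff_nsmul_eq_zero.1 hdvd
  · rw [le_antisymm hmK hge]

/-- Conversely, an element of additive order `p^K`, `K ≥ 1`, is not killed by `p^(K-1)`. [folklore] -/
theorem pow_pred_nsmul_ne_zero_of_addOrderOf_eq (x : A) {K : ℕ} (hK : 0 < K)
    (hx : addOrderOf x = p ^ K) : p ^ (K - 1) • x ≠ 0 := by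
  intro h
  have hdvd : p ^ K ∣ p ^ (K - 1) := hx ▸ addOrderOf_dvd_of_nsmul_eq_zero h
  have hle : p ^ K ≤ p ^ (K - 1) := Nat.le_of_dvd (pow_pos hp.out.pos _) hdvd
  have hlt : p ^ (K - 1) < p ^ K := Nat.pow_lt_pow_right hp.out.one_lt (by omega)
  omega

/-- The `p^r`-multiple of an element of additive order `p^(K₀ + r)` has additive order `p^K₀`
(`K₀ ≥ 1`). [folklore] -/
theorem addOrderOf_pow_nsmul_of_addOrderOf_eq (y : A) {K₀ r : ℕ} (hK₀ : 0 < K₀)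
    (hy : addOrderOf y = p ^ (K₀ + r)) : addOrderOf (p ^ r • y) = p ^ K₀ := by
  apply addOrderOf_eq_pow_of_nsmul _ hK₀
  · rw [← mul_smul, ← pow_add, ← hy]
    exact addOrderOf_nsmul_eq_zero y
  · rw [← mul_smul, ← pow_add, show K₀ - 1 + r = K₀ + r - 1 by omega]
    exact pow_pred_nsmul_ne_zero_of_addOrderOf_eq y (by omega) hy

/-- If `y` has additive order `p^K₀` (`K₀ ≥ 1`) and so does `w • y`, then `p ∤ w`. [folklore] -/
theorem not_dvd_of_addOrderOf_nsmul_eq (y : A) {K₀ : ℕ} (hK₀ : 0 < K₀)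
    (hy : addOrderOf y = p ^ K₀) (w : ℕ) (hw : addOrderOf (w • y) = p ^ K₀) : ¬ p ∣ w := by
  rintro ⟨w', rfl⟩
  apply pow_pred_nsmul_ne_zero_of_addOrderOf_eq ((p * w') • y) hK₀ hw
  rw [← mul_smul, ← mul_assoc, ← pow_succ, Nat.sub_add_cancel hK₀, mul_comm (p ^ K₀) w',
    mul_smul, ← hy, addOrderOf_nsmul_eq_zero, smul_zero]
end Orders

/-! ## §1 Generators of a group that is free of rank one over `ℤ/N`; a coordinate of full order -/
section Generators
/-- **A generator from `X ≃+ ℤ/N`**: there is `g : X` of additive order `N` such that every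
element of `X` is a natural multiple of `g` (the tree's `KolyvaginSystem.IsFreeRankOneZMod`, the
conclusion (1) of Sakamoto's Thm. 4.4 as typed). [cite: Sakamoto2024, Thm. 4.4 (1) (p. 926)] -/
theorem exists_generator_of_isFreeRankOneZMod {X : Type*} [AddCommGroup X] {N : ℕ} [NeZero N]
    (h : KolyvaginSystem.IsFreeRankOneZMod X N) :
    ∃ g : X, addOrderOf g = N ∧ ∀ x : X, ∃ a : ℕ, a < N ∧ x = a • g := by
  obtain ⟨e⟩ := h
  refine ⟨e.symm 1, ?_, fun x => ⟨(e x).val, ZMod.val_lt _, ?_⟩⟩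
  · rw [AddEquiv.addOrderOf_eq, ZMod.addOrderOf_one]
  · apply e.injective
    rw [map_nsmul, AddEquiv.apply_symm_apply, nsmul_eq_mul, mul_one, ZMod.natCast_zmod_val]

/-- The same for an additive subgroup (the tree's `D.kolyvaginSystems 𝓕` is an `AddSubgroup` of
`Finset _ → H¹(K, T)`): a generator `g ∈ H` of additive order `N` with `H ⊆ ℕ • g`.
[cite: Sakamoto2024, Thm. 4.4 (1) (p. 926)] -/
theorem exists_mem_generator_of_isFreeRankOneZMod {Y : Type*} [AddCommGroup Y] (H : AddSubgroup Y)
    {N : ℕ} [NeZero N] (h : KolyvaginSystem.IsFreeRankOneZMod H N) :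
    ∃ g ∈ H, addOrderOf g = N ∧ ∀ x ∈ H, ∃ a : ℕ, a < N ∧ x = a • g := by
  obtain ⟨g, hg, hgen⟩ := exists_generator_of_isFreeRankOneZMod h
  refine ⟨g, g.2, ?_, fun x hx => ?_⟩
  · rw [← hg]
    exact addOrderOf_injective H.subtype Subtype.coe_injective g
  · obtain ⟨a, ha, hax⟩ := hgen ⟨x, hx⟩
    exact ⟨a, ha, by simpa using congrArg Subtype.val hax⟩

variable {ι A : Type*} [AddCommGroup A] {p : ℕ} [hp : Fact p.Prime]

/-- **A family of additive order `p^K` (`K ≥ 1`) has a coordinate of additive order `p^K`.**  For the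
generator `g` of `KS₁(T, 𝓕) ≃ ℤ/p^K` this is a level `d₀` with `addOrderOf (g d₀) = p^K`, hence
(Thm. 4.4 (2), order form) a CORE vertex `#N_{d₀} = 1` — skeleton step S2. [folklore] -/
theorem exists_addOrderOf_apply_eq_pow (g : ι → A) {K : ℕ} (hK : 0 < K)
    (hg : addOrderOf g = p ^ K) : ∃ i, addOrderOf (g i) = p ^ K := by
  have h1 : p ^ (K - 1) • g ≠ 0 := pow_pred_nsmul_ne_zero_of_addOrderOf_eq g hK hg
  obtain ⟨i, hi⟩ : ∃ i, (p ^ (K - 1) • g) i ≠ (0 : ι → A) i := Function.ne_iff.mp h1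
  refine ⟨i, addOrderOf_eq_pow_of_nsmul _ hK ?_ (by simpa using hi)⟩
  have h0 : p ^ K • g = 0 := by rw [← hg]; exact addOrderOf_nsmul_eq_zero g
  simpa using congrFun h0 i
end Generators

/-! ## §2 The unitriangular bridge and the certificate step (skeleton step S1) -/
section Bridge
variable {ι A R : Type*} [AddCommGroup A] [CommRing R]

/-- **Unitriangular bridge** ([MR04] App. A eq. (33): the corrected class `κ′_d` differs from the
derivative class `κ_d` by a combination of the `κ_c`, `c ⊊ d`): if a functional `L` sends every
`κ_c`, `c ⊊ d`, into an ideal `J`, then `L κ′_d − L κ_d ∈ J`.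
[cite: MazurRubin2004, App. A eq. (33) (p. 80)] -/
theorem apply_sub_apply_mem_of_sub_mem_closure (L : A →+ R) (J : Ideal R)
    (κ κ' : Finset ι → A) (d : Finset ι)
    (hbridge : κ' d - κ d ∈ AddSubgroup.closure {x | ∃ c, c ⊂ d ∧ x = κ c})
    (hJ : ∀ c, c ⊂ d → L (κ c) ∈ J) : L (κ' d) - L (κ d) ∈ J := by
  rw [← map_sub]
  have hle : AddSubgroup.closure {x | ∃ c, c ⊂ d ∧ x = κ c} ≤
      J.toAddSubgroup.comap L := by
    rw [AddSubgroup.closure_le]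
    rintro x ⟨c, hc, rfl⟩
    exact hJ c hc
  exact hle hbridge

/-- Hence `L κ′_d ∈ J ↔ L κ_d ∈ J`. [cite: MazurRubin2004, App. A eq. (33) (p. 80)] -/
theorem apply_mem_iff_of_sub_mem_closure (L : A →+ R) (J : Ideal R)
    (κ κ' : Finset ι → A) (d : Finset ι)
    (hbridge : κ' d - κ d ∈ AddSubgroup.closure {x | ∃ c, c ⊂ d ∧ x = κ c})
    (hJ : ∀ c, c ⊂ d → L (κ c) ∈ J) : L (κ' d) ∈ J ↔ L (κ d) ∈ J := by
  have h := apply_sub_apply_mem_of_sub_mem_closure L J κ κ' d hbridge hJ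
  constructor
  · intro h'
    have := J.sub_mem h' h
    rwa [sub_sub_cancel] at this
  · intro h'
    have := J.add_mem h h'
    rwa [sub_add_cancel] at this

/-- **The certificate step**: if `y = a • x` (`a : ℕ`) and `L y ∉ J`, then `(a : R) ∉ J` and
`L x ∉ J`.  With `y = κ′_d`, `x = g_d` (the generator's class) and `J = (p^{t+j})` this is
"`ord_p a ≤ t + j − 1`". [cite: Kim2022StructureSelmer, Thm. 1.9 (6) and §1.4.3] -/
theorem natCast_not_mem_of_apply_nsmul_not_mem (L : A →+ R) (J : Ideal R) (x : A) (a : ℕ)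
    (h : L (a • x) ∉ J) : (a : R) ∉ J ∧ L x ∉ J := by
  rw [map_nsmul, nsmul_eq_mul] at h
  exact ⟨fun ha => h (J.mul_mem_right _ ha), fun hx => h (J.mul_mem_left _ hx)⟩
end Bridge

/-! ## §3 Scalar transport through one core vertex (skeleton step S3) -/
section Transport
variable {A A' : Type*} [AddCommGroup A] [AddCommGroup A'] {p : ℕ} [hp : Fact p.Prime]

/-- **Onto at a core vertex forces a unit.**  Let `ι : A → A′` be injective and `φ : A′ → A`
additive with `ι (φ y′) = p^r • y′` (the pair `incl_*`, `red_*` between the levels `K₀` and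
`K₀ + r`: `incl ∘ red = p^r`), `y′` of additive order `p^(K₀+r)`, and `φ y′ = w • y` with `y` of
additive order `p^K₀`, `K₀ ≥ 1`.  Then `p ∤ w`. [cite: MazurRubin2004, Thm. 4.4.1 (p. 45)] -/
theorem not_dvd_of_comp_eq_pow_nsmul (ι : A →+ A') (hι : Function.Injective ι) (φ : A' →+ A)
    {K₀ r : ℕ} (hK₀ : 0 < K₀) (y' : A') (hy' : addOrderOf y' = p ^ (K₀ + r))
    (hcomp : ι (φ y') = p ^ r • y') (y : A) (hy : addOrderOf y = p ^ K₀) (w : ℕ)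
    (hw : φ y' = w • y) : ¬ p ∣ w := by
  apply not_dvd_of_addOrderOf_nsmul_eq y hK₀ hy w
  rw [← hw, ← addOrderOf_injective ι hι (φ y'), hcomp]
  exact addOrderOf_pow_nsmul_of_addOrderOf_eq y' hK₀ hy'

/-- **Scalar transport**: if `y` has additive order `p^K₀`, `(a′ * w) • y = a • y` and `p ∤ w`,
then for every `s ≤ K₀`, `p^s ∣ a ↔ p^s ∣ a′` — "`ord_p a′ = ord_p a` below `K₀`".  (Here
`a • y = κ′₀_{d₀}`, `a′ • (w • y) = red_*(κ′_{d₀}) = red_*(a′ • g′_{d₀})`.)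
[cite: MazurRubin2004, Thm. 4.4.1 (p. 45)] -/
theorem pow_dvd_iff_of_mul_nsmul_eq_nsmul (y : A) {K₀ : ℕ} (hy : addOrderOf y = p ^ K₀)
    {a a' w : ℕ} (hw : ¬ p ∣ w) (h : (a' * w) • y = a • y) {s : ℕ} (hs : s ≤ K₀) :
    p ^ s ∣ a ↔ p ^ s ∣ a' := by
  -- `p^K₀ ∣ a′w − a` in `ℤ`
  have hz : (((a' * w : ℕ) : ℤ) - ((a : ℕ) : ℤ)) • y = 0 := by
    rw [sub_smul, natCast_zsmul, natCast_zsmul, h, sub_self]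
  have hdvd : ((p ^ K₀ : ℕ) : ℤ) ∣ ((a' * w : ℕ) : ℤ) - ((a : ℕ) : ℤ) := by
    rw [← hy]
    exact addOrderOf_dvd_iff_zsmul_eq_zero.2 hz
  have hdvd' : ((p ^ s : ℕ) : ℤ) ∣ ((a' * w : ℕ) : ℤ) - ((a : ℕ) : ℤ) :=
    (Int.natCast_dvd_natCast.2 (Nat.pow_dvd_pow p hs)).trans hdvd
  have hcop : Nat.Coprime (p ^ s) w :=
    (Nat.Coprime.pow_left s ((Nat.Prime.coprime_iff_not_dvd hp.out).2 hw))
  constructor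
  · intro ha
    have h1 : ((p ^ s : ℕ) : ℤ) ∣ ((a' * w : ℕ) : ℤ) := by
      have := dvd_add hdvd' (Int.natCast_dvd_natCast.2 ha)
      rwa [sub_add_cancel] at this
    exact hcop.dvd_of_dvd_mul_right (Int.natCast_dvd_natCast.1 h1)
  · intro ha'
    have h1 : ((p ^ s : ℕ) : ℤ) ∣ ((a' * w : ℕ) : ℤ) :=
      Int.natCast_dvd_natCast.2 (ha'.mul_right w)
    have h2 := dvd_sub h1 hdvd'
    rw [sub_sub_cancel] at h2
    exact Int.natCast_dvd_natCast.1 h2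
end Transport

/-! ## §4 The deep-ledger lemma (skeleton step S5) -/
section DeepLedger
variable {G : Type*} [AddCommGroup G] {p : ℕ} [hp : Fact p.Prime]

omit hp in
/-- **The deep-ledger lemma.**  `G` an abelian group (`H¹_{𝓕_can}(ℚ, E[p^K])`), `Λ : G → ℤ/p^K`
additive (`Λ ∘ loc_p`), whose kernel (`= Sel_{p^K}(E) ≅ Ш[p^K]`) is killed by `p^X`; `x ∈ G` with
`Λ x = p^c` and `p^K x = 0`; `g ∈ G` (the generator's bottom class `g_∅`) with `Λ g = p^β · u`; and
`X + β ≤ K + c` (the DEEP level).  Then `p^{K+c−β} • g = 0`: writing `g = s + m • x` with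
`m = p^{β−c} u` and `s ∈ ker Λ`, both summands die.  [folklore] -/
theorem pow_nsmul_eq_zero_of_ledger {K X c β : ℕ} (Λ : G →+ ZMod (p ^ K))
    (hX : ∀ s : G, Λ s = 0 → p ^ X • s = 0) (x : G) (hx : Λ x = ((p ^ c : ℕ) : ZMod (p ^ K)))
    (hxK : p ^ K • x = 0) (g : G) (u : ℕ) (hg : Λ g = ((p ^ β * u : ℕ) : ZMod (p ^ K)))
    (hcβ : c ≤ β) (hK : X + β ≤ K + c) : p ^ (K + c - β) • g = 0 := by
  set m : ℕ := p ^ (β - c) * u with hm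
  have hs : Λ (g - m • x) = 0 := by
    rw [map_sub, map_nsmul, hx, hg, nsmul_eq_mul, ← Nat.cast_mul, sub_eq_zero]
    congr 1
    rw [hm, mul_right_comm, ← pow_add, Nat.sub_add_cancel hcβ]
  have h1 : p ^ (K + c - β) • (g - m • x) = 0 := by
    obtain ⟨r, hr⟩ : ∃ r, K + c - β = X + r := ⟨K + c - β - X, by omega⟩
    rw [hr, pow_add, mul_comm (p ^ X) (p ^ r), mul_smul, hX _ hs, smul_zero]
  have h2 : p ^ (K + c - β) • (m • x) = 0 := by
    rw [← mul_smul, hm, ← mul_assoc, ← pow_add, show K + c - β + (β - c) = K by omega,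
      mul_comm (p ^ K) u, mul_smul, hxK, smul_zero]
  calc p ^ (K + c - β) • g
      = p ^ (K + c - β) • (g - m • x) + p ^ (K + c - β) • (m • x) := by
        rw [← smul_add, sub_add_cancel]
    _ = 0 := by rw [h1, h2, add_zero]

/-- **With the ORDER form of Thm. 4.4 (2)** (`addOrderOf g · N = p^K`, R1-22's first clause at
`d = ∅`, `N = #H¹_{𝓕^*}(ℚ, T^∨(1))`): `p^{K+c−β} • g = 0` gives `p^{β−c} ∣ N`.
[cite: Sakamoto2024, Thm. 4.4 (2) (p. 926)] -/
theorem pow_dvd_of_addOrderOf_mul_eq (g : G) {K c β N : ℕ} (hord : addOrderOf g * N = p ^ K)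
    (hkill : p ^ (K + c - β) • g = 0) (hβ : β ≤ K + c) : p ^ (β - c) ∣ N := by
  have hg : addOrderOf g ∣ p ^ (K + c - β) := addOrderOf_dvd_of_nsmul_eq_zero hkill
  obtain ⟨i, hi, hgi⟩ := (Nat.dvd_prime_pow hp.out).1 hg
  have hN : N ∣ p ^ K := Dvd.intro_left _ hord
  obtain ⟨l, hl, hNl⟩ := (Nat.dvd_prime_pow hp.out).1 hN
  rw [hgi, hNl, ← pow_add] at hord
  have hil : i + l = K := Nat.pow_right_injective hp.out.two_le hord
  rw [hNl]
  exact Nat.pow_dvd_pow p (by omega)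

omit hp in
/-- **The count.**  If moreover `#S = p^c · N` (`S = ker Λ`; the finite Poitou–Tate count
`#H¹_{𝓕_can} = p^K · #N_∅` read through `Λ`), then `p^β ∣ #S`.
[cite: Sakamoto2024, Thm. 4.4 (2) (p. 926)] -/
theorem pow_dvd_card_of_ledger {c β N S : ℕ} (hN : p ^ (β - c) ∣ N) (hcβ : c ≤ β)
    (hS : S = p ^ c * N) : p ^ β ∣ S := by
  rw [hS, ← Nat.sub_add_cancel hcβ, pow_add, mul_comm (p ^ (β - c))]
  exact Nat.mul_dvd_mul_left _ hN
end DeepLedger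

/-! ## §5 Valuation dictionary in `ℤ/p^K` -/
section Dictionary
variable {p : ℕ} [hp : Fact p.Prime]

omit hp in
/-- `p^s ∣ a` in `ℕ` iff `(p^s : ℤ/p^K) ∣ (a : ℤ/p^K)`, for `s ≤ K`. [folklore] -/
theorem pow_dvd_natCast_iff {K s : ℕ} (hs : s ≤ K) (a : ℕ) :
    ((p ^ s : ℕ) : ZMod (p ^ K)) ∣ (a : ZMod (p ^ K)) ↔ p ^ s ∣ a := by
  constructor
  · rintro ⟨r, hr⟩
    have h := congrArg (ZMod.castHom (Nat.pow_dvd_pow p hs) (ZMod (p ^ s))) hr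
    rw [map_natCast, map_mul, map_natCast, ZMod.natCast_self, zero_mul] at h
    rwa [ZMod.natCast_eq_zero_iff] at h
  · rintro ⟨b, rfl⟩
    exact ⟨b, by push_cast; ring⟩

/-- If `p^t · x = 0` in `ℤ/p^K` with `t ≤ K` then `p^{K−t} ∣ x`. [folklore] -/
theorem pow_dvd_of_pow_mul_eq_zero {K t : ℕ} (ht : t ≤ K) (x : ZMod (p ^ K))
    (h : ((p ^ t : ℕ) : ZMod (p ^ K)) * x = 0) : ((p ^ (K - t) : ℕ) : ZMod (p ^ K)) ∣ x := by
  haveI : NeZero (p ^ K) := ⟨pow_ne_zero K hp.out.ne_zero⟩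
  rw [← ZMod.natCast_zmod_val x, ← Nat.cast_mul, ZMod.natCast_eq_zero_iff] at h
  obtain ⟨q, hq⟩ := h
  have hq' : p ^ t * x.val = p ^ t * (p ^ (K - t) * q) := by
    rw [← mul_assoc, ← pow_add, Nat.add_sub_cancel' ht]
    exact hq
  have hval : x.val = p ^ (K - t) * q := Nat.eq_of_mul_eq_mul_left (pow_pos hp.out.pos t) hq'
  rw [← ZMod.natCast_zmod_val x, hval, Nat.cast_mul]
  exact Dvd.intro q rfl

/-- **`p^t · δ ∈ (p^{t+j}) ↔ δ ∈ (p^j)` in `ℤ/p^K` for `t + j ≤ K`** — the step "`u·3^t·δ̃_n ≢ 0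
(mod 3^{t+j})` iff `δ̃_n ≢ 0 (mod 3^j)`" of S1, and the reason for the DEPTH SHIFT `k ≥ j + t`.
[cite: Kim2022StructureSelmer, Lemma 3.14 (`∂(p^t δ̃) = ∂(δ̃) + t`)] -/
theorem pow_mul_dvd_pow_add_mul_iff {K t j : ℕ} (htj : t + j ≤ K) (δ : ZMod (p ^ K)) :
    ((p ^ (t + j) : ℕ) : ZMod (p ^ K)) ∣ ((p ^ t : ℕ) : ZMod (p ^ K)) * δ ↔
      ((p ^ j : ℕ) : ZMod (p ^ K)) ∣ δ := by
  constructor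
  · rintro ⟨r, hr⟩
    -- `p^t (δ − p^j r) = 0`, so `p^{K−t} ∣ δ − p^j r`, and `p^j ∣ p^{K−t}`
    have h0 : ((p ^ t : ℕ) : ZMod (p ^ K)) * (δ - ((p ^ j : ℕ) : ZMod (p ^ K)) * r) = 0 := by
      rw [mul_sub, hr, ← mul_assoc, ← Nat.cast_mul, ← pow_add, sub_self]
    have h1 := pow_dvd_of_pow_mul_eq_zero (by omega) _ h0
    have h2 : ((p ^ j : ℕ) : ZMod (p ^ K)) ∣ ((p ^ (K - t) : ℕ) : ZMod (p ^ K)) :=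
      Nat.cast_dvd_cast (Nat.pow_dvd_pow p (by omega))
    have h3 := h2.trans h1
    have h4 : ((p ^ j : ℕ) : ZMod (p ^ K)) ∣ ((p ^ j : ℕ) : ZMod (p ^ K)) * r := Dvd.intro r rfl
    simpa using h3.add h4
  · rintro ⟨r, rfl⟩
    exact ⟨r, by rw [← mul_assoc, ← Nat.cast_mul, ← pow_add]⟩

omit hp in
/-- Reading of the certificate: for `a : ℕ` and `s ≤ K`, `(a : ℤ/p^K) ∉ (p^s)` iff `¬ p^s ∣ a`.
[folklore] -/
theorem natCast_not_mem_span_pow_iff {K s : ℕ} (hs : s ≤ K) (a : ℕ) :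
    (a : ZMod (p ^ K)) ∉ Ideal.span {((p ^ s : ℕ) : ZMod (p ^ K))} ↔ ¬ p ^ s ∣ a := by
  rw [Ideal.mem_span_singleton, pow_dvd_natCast_iff hs]

omit hp in
/-- In `ℤ/p^K`: a unit plus a multiple of `p` is a unit (`p` is nilpotent). [folklore] -/
theorem isUnit_add_natCast_mul {K : ℕ} (w : (ZMod (p ^ K))ˣ) (z : ZMod (p ^ K)) :
    IsUnit ((w : ZMod (p ^ K)) + (p : ZMod (p ^ K)) * z) := by
  have hnil : IsNilpotent ((p : ZMod (p ^ K)) * z) := by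
    refine ⟨K, ?_⟩
    rw [mul_pow, ← Nat.cast_pow, ZMod.natCast_self, zero_mul]
  exact hnil.isUnit_add_left_of_commute w.isUnit (Commute.all _ _)

/-- **Visibility of the `L`-value at a deep level** (skeleton step S4): in `ℤ/p^K`, if
`(p^α b) · y = p^m · w` with `w` a unit, `p ∤ b`, `α ≤ m < K`, then `y = p^{m−α} · w′` for a unit
`w′` — "`ord_p y = m − α`".  (In R1-23: `a · y = Λ(loc κ′_∅) = u·p^t·δ̃_1`, `a = p^α b` the
transported scalar, `m = t + v`, `y = Λ(loc g_∅)`.) [folklore] -/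
theorem exists_eq_pow_mul_unit_of_natCast_mul_eq {K m α b : ℕ} (hm : m < K) (hα : α ≤ m)
    (hb : ¬ p ∣ b) (y : ZMod (p ^ K)) (w : (ZMod (p ^ K))ˣ)
    (h : ((p ^ α * b : ℕ) : ZMod (p ^ K)) * y =
      ((p ^ m : ℕ) : ZMod (p ^ K)) * (w : ZMod (p ^ K))) :
    ∃ w' : (ZMod (p ^ K))ˣ, y = ((p ^ (m - α) : ℕ) : ZMod (p ^ K)) * (w' : ZMod (p ^ K)) := by
  haveI : NeZero (p ^ K) := ⟨pow_ne_zero K hp.out.ne_zero⟩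
  have hcop : Nat.Coprime b (p ^ K) :=
    Nat.Coprime.pow_right K ((Nat.Prime.coprime_iff_not_dvd hp.out).2 hb).symm
  set ub : (ZMod (p ^ K))ˣ := ZMod.unitOfCoprime b hcop with hub
  have hubval : (ub : ZMod (p ^ K)) = (b : ZMod (p ^ K)) := ZMod.coe_unitOfCoprime b hcop
  -- `p^α · (b y − p^{m−α} w) = 0`
  have h0 : ((p ^ α : ℕ) : ZMod (p ^ K)) *
      ((b : ZMod (p ^ K)) * y - ((p ^ (m - α) : ℕ) : ZMod (p ^ K)) * (w : ZMod (p ^ K))) = 0 := by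
    rw [mul_sub, ← mul_assoc, ← Nat.cast_mul, h, ← mul_assoc, ← Nat.cast_mul, ← pow_add,
      Nat.add_sub_cancel' hα, sub_self]
  -- hence `b y − p^{m−α} w = p^{K−α} z`
  obtain ⟨z, hz⟩ := pow_dvd_of_pow_mul_eq_zero (p := p) (show α ≤ K by omega) _ h0
  -- `p^{K−α} = p^{m−α} · p · p^{K−m−1}`
  have hsplit : ((p ^ (K - α) : ℕ) : ZMod (p ^ K)) =
      ((p ^ (m - α) : ℕ) : ZMod (p ^ K)) *
        ((p : ZMod (p ^ K)) * ((p ^ (K - m - 1) : ℕ) : ZMod (p ^ K))) := by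
    have hexp : K - α = (m - α) + (1 + (K - m - 1)) := by omega
    rw [hexp, pow_add, pow_add, pow_one]
    push_cast
    ring
  -- so `b y = p^{m−α} (w + p · (p^{K−m−1} z))`, and the bracket is a unit
  obtain ⟨e, he⟩ := isUnit_add_natCast_mul (p := p) w (((p ^ (K - m - 1) : ℕ) : ZMod (p ^ K)) * z)
  have hby : (ub : ZMod (p ^ K)) * y = ((p ^ (m - α) : ℕ) : ZMod (p ^ K)) * (e : ZMod (p ^ K)) := by
    rw [hubval, he]
    linear_combination hz + z * hsplit
  refine ⟨ub⁻¹ * e, ?_⟩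
  calc y = ((ub⁻¹ : (ZMod (p ^ K))ˣ) : ZMod (p ^ K)) * ((ub : ZMod (p ^ K)) * y) := by
          rw [← mul_assoc, Units.inv_mul, one_mul]
    _ = ((p ^ (m - α) : ℕ) : ZMod (p ^ K)) * ((ub⁻¹ * e : (ZMod (p ^ K))ˣ) : ZMod (p ^ K)) := by
          rw [hby, Units.val_mul]
          ring
end Dictionary

end Summit.BirchSwinnertonDyer.Rank1Residual.GaloisImage.Ledger
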